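import Summits.CriticalPhenomena.PercolationContinuityZ3.Theorems.PercNearOneGluingAdditiveGluingKnLemma2General
import HarnessLib

/-!
# `NoHeavyLowerTail` (stmt-CriticalPhenomena-4575) — Kozma–Nitzan's Lemma 2 for a pair, with explicit separation events

Support file (prover `prim-lf-7`; `--supports stmt-CriticalPhenomena-4575`).  No definitions, no named facts, no sorries.

`GiantKn.lemma2_pair`: the instance `R = {c,x,y}`, `T = {x,y}` of `knK_lemma2` (KN Lemma 2 for any number of relays, crux-4576 support
file `…AdditiveGluingKnLemma2General`), restated with the events `{x↮y, x↮c}`, `{y↮x, y↮c}`, `{x↮c, y↮c}` and the attachments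
`{o↔x}`, `{o↔y}`, `{o↔x} ∪ {o↔y}` spelled out:  `φ_x + φ_y ≤ φ_{xy}`.  `GiantKn.sep_pos`: the three conditioning events have positive
mass as soon as the full separation event does.  Used by `xz2_of_knRegime` (sequel file `…GiantKnTheoremTwo.lean`).
-/

noncomputable section

namespace Summit.CriticalPhenomena.PercolationContinuityZ3.Theorems

open MeasureTheory Set Literature.Probability.LatticeModels Literature.Probability.Percolation
open scoped Classical BigOperators

variable {n : ℕ}

namespace GiantKn

/-- Positivity of the three separation events `{x↮c, y↮c}`, `{x↮y, x↮c}`, `{y↮x, y↮c}` from the positivity of the full separation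
event `M = {x, y separated from each other and from c}` (each contains `M`). -/
theorem sep_pos (w : Sym2 (Fin n) → unitInterval) (c x y : Fin n) (hxy : x ≠ y) (hxc : x ≠ c) (hyc : y ≠ c)
    (hM : 0 < (prodBernoulli w).real {ω : BondConfig (Fin n) | ∀ k ∈ ({x, y} : Finset (Fin n)), ∀ l ∈ ({c, x, y} : Finset (Fin n)),
      k ≠ l → ¬ (openGraph ω).Reachable k l}) :
    0 < (prodBernoulli w).real {ω : BondConfig (Fin n) | ¬ (openGraph ω).Reachable x c ∧ ¬ (openGraph ω).Reachable y c} ∧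
      0 < (prodBernoulli w).real {ω : BondConfig (Fin n) | ¬ (openGraph ω).Reachable x y ∧ ¬ (openGraph ω).Reachable x c} ∧
      0 < (prodBernoulli w).real {ω : BondConfig (Fin n) | ¬ (openGraph ω).Reachable y x ∧ ¬ (openGraph ω).Reachable y c} := by
  have hMle : ∀ (Dk : Set (BondConfig (Fin n))), {ω : BondConfig (Fin n) | ∀ k ∈ ({x, y} : Finset (Fin n)), ∀ l ∈ ({c, x, y} : Finset (Fin n)),
      k ≠ l → ¬ (openGraph ω).Reachable k l} ⊆ Dk → 0 < (prodBernoulli w).real Dk :=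
    fun Dk h => lt_of_lt_of_le hM (measureReal_mono h (measure_ne_top _ _))
  refine ⟨hMle _ ?_, hMle _ ?_, hMle _ ?_⟩
  · intro ω hω; simp only [mem_setOf_eq, Finset.mem_insert, Finset.mem_singleton] at hω
    exact ⟨hω x (Or.inl rfl) c (Or.inl rfl) hxc, hω y (Or.inr rfl) c (Or.inl rfl) hyc⟩
  · intro ω hω; simp only [mem_setOf_eq, Finset.mem_insert, Finset.mem_singleton] at hω
    exact ⟨hω x (Or.inl rfl) y (Or.inr (Or.inr rfl)) hxy, hω x (Or.inl rfl) c (Or.inl rfl) hxc⟩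
  · intro ω hω; simp only [mem_setOf_eq, Finset.mem_insert, Finset.mem_singleton] at hω
    exact ⟨hω y (Or.inr rfl) x (Or.inr (Or.inl rfl)) hxy.symm, hω y (Or.inr rfl) c (Or.inl rfl) hyc⟩

/-- **Kozma–Nitzan Lemma 2 for the pair `{x, y}` against `c` (PROVED)**, with the separation events spelled out:
`φ_x + φ_y ≤ φ_{xy}`, i.e. `μ(o↔x | x↮y, x↮c) + μ(o↔y | y↮x, y↮c) ≤ μ(o↔x ∨ o↔y | x↮c, y↮c)` — the instance `R = {c,x,y}`, `T = {x,y}`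
of `knK_lemma2`.  [cite: KozmaNitzan2024, Lemma 2 (p. 6)] -/
theorem lemma2_pair (w : Sym2 (Fin n) → unitInterval) (o c x y : Fin n) (hxy : x ≠ y) (hxc : x ≠ c) (hyc : y ≠ c)
    (hM : 0 < (prodBernoulli w).real {ω : BondConfig (Fin n) | ∀ k ∈ ({x, y} : Finset (Fin n)), ∀ l ∈ ({c, x, y} : Finset (Fin n)),
      k ≠ l → ¬ (openGraph ω).Reachable k l}) :
    (prodBernoulli w).real ({ω : BondConfig (Fin n) | ¬ (openGraph ω).Reachable x y ∧ ¬ (openGraph ω).Reachable x c} ∩ openConn o x) /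
          (prodBernoulli w).real {ω : BondConfig (Fin n) | ¬ (openGraph ω).Reachable x y ∧ ¬ (openGraph ω).Reachable x c} +
        (prodBernoulli w).real ({ω : BondConfig (Fin n) | ¬ (openGraph ω).Reachable y x ∧ ¬ (openGraph ω).Reachable y c} ∩ openConn o y) /
          (prodBernoulli w).real {ω : BondConfig (Fin n) | ¬ (openGraph ω).Reachable y x ∧ ¬ (openGraph ω).Reachable y c} ≤
      (prodBernoulli w).real ({ω : BondConfig (Fin n) | ¬ (openGraph ω).Reachable x c ∧ ¬ (openGraph ω).Reachable y c} ∩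
            (openConn o x ∪ openConn o y)) /
        (prodBernoulli w).real {ω : BondConfig (Fin n) | ¬ (openGraph ω).Reachable x c ∧ ¬ (openGraph ω).Reachable y c} := by
  have hsub : ({x, y} : Finset (Fin n)) ⊆ ({c, x, y} : Finset (Fin n)) := by
    intro v hv'; simp only [Finset.mem_insert, Finset.mem_singleton] at hv' ⊢; tauto
  have hL2 := knK_lemma2 w o ({c, x, y} : Finset (Fin n)) ({x, y} : Finset (Fin n)) hsub hM
  have eDT : {ω : BondConfig (Fin n) | ∀ s ∈ ({x, y} : Finset (Fin n)), ∀ x' ∈ (↑(({c, x, y} : Finset (Fin n)) \ {x, y}) : Set (Fin n)),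
      ¬ (openGraph ω).Reachable s x'} = {ω : BondConfig (Fin n) | ¬ (openGraph ω).Reachable x c ∧ ¬ (openGraph ω).Reachable y c} := by
    ext ω
    have hsd : (↑(({c, x, y} : Finset (Fin n)) \ {x, y}) : Set (Fin n)) = {c} := by
      ext v; simp only [Finset.coe_sdiff, Finset.coe_insert, Finset.coe_singleton, mem_sdiff, mem_insert_iff, mem_singleton_iff]
      constructor
      · rintro ⟨h1, h2⟩; push Not at h2; tauto
      · rintro rfl; exact ⟨Or.inl rfl, fun h => h.elim (fun h => hxc h.symm) (fun h => hyc h.symm)⟩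
    simp only [mem_setOf_eq, hsd, Finset.mem_insert, Finset.mem_singleton, mem_singleton_iff, forall_eq_or_imp, forall_eq]
  have eDx : {ω : BondConfig (Fin n) | ∀ x' ∈ ({c, x, y} : Finset (Fin n)).erase x, ¬ (openGraph ω).Reachable x x'} =
      {ω : BondConfig (Fin n) | ¬ (openGraph ω).Reachable x y ∧ ¬ (openGraph ω).Reachable x c} := by
    ext ω
    simp only [mem_setOf_eq, Finset.mem_erase, Finset.mem_insert, Finset.mem_singleton]
    constructor
    · intro h; exact ⟨h y ⟨hxy.symm, Or.inr (Or.inr rfl)⟩, h c ⟨hxc.symm, Or.inl rfl⟩⟩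
    · rintro ⟨h1, h2⟩ v ⟨hv, hv'⟩
      rcases hv' with rfl | rfl | rfl
      · exact h2
      · exact absurd rfl hv
      · exact h1
  have eDy : {ω : BondConfig (Fin n) | ∀ x' ∈ ({c, x, y} : Finset (Fin n)).erase y, ¬ (openGraph ω).Reachable y x'} =
      {ω : BondConfig (Fin n) | ¬ (openGraph ω).Reachable y x ∧ ¬ (openGraph ω).Reachable y c} := by
    ext ω
    simp only [mem_setOf_eq, Finset.mem_erase, Finset.mem_insert, Finset.mem_singleton]
    constructor
    · intro h; exact ⟨h x ⟨hxy, Or.inr (Or.inl rfl)⟩, h c ⟨hyc.symm, Or.inl rfl⟩⟩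
    · rintro ⟨h1, h2⟩ v ⟨hv, hv'⟩
      rcases hv' with rfl | rfl | rfl
      · exact h2
      · exact h1
      · exact absurd rfl hv
  have eAT : ({ω : BondConfig (Fin n) | ∀ s ∈ ({x, y} : Finset (Fin n)), ∀ x' ∈ (↑(({c, x, y} : Finset (Fin n)) \ {x, y}) : Set (Fin n)),
      ¬ (openGraph ω).Reachable s x'} ∩ ⋃ s ∈ ({x, y} : Finset (Fin n)), (openConn s o : Set (BondConfig (Fin n)))) =
      {ω : BondConfig (Fin n) | ¬ (openGraph ω).Reachable x c ∧ ¬ (openGraph ω).Reachable y c} ∩ (openConn o x ∪ openConn o y) := by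
    rw [eDT]; congr 1
    ext ω; simp only [mem_iUnion, exists_prop, Finset.mem_insert, Finset.mem_singleton, mem_union, openConn, mem_setOf_eq]
    constructor
    · rintro ⟨s, (rfl | rfl), hs⟩
      · exact Or.inl hs.symm
      · exact Or.inr hs.symm
    · rintro (h | h)
      · exact ⟨x, Or.inl rfl, h.symm⟩
      · exact ⟨y, Or.inr rfl, h.symm⟩
  have eAx : ({ω : BondConfig (Fin n) | ∀ x' ∈ ({c, x, y} : Finset (Fin n)).erase x, ¬ (openGraph ω).Reachable x x'} ∩ openConn x o) =
      {ω : BondConfig (Fin n) | ¬ (openGraph ω).Reachable x y ∧ ¬ (openGraph ω).Reachable x c} ∩ openConn o x := by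
    rw [eDx]; congr 1; ext ω; simp only [openConn, mem_setOf_eq]; exact ⟨fun h => h.symm, fun h => h.symm⟩
  have eAy : ({ω : BondConfig (Fin n) | ∀ x' ∈ ({c, x, y} : Finset (Fin n)).erase y, ¬ (openGraph ω).Reachable y x'} ∩ openConn y o) =
      {ω : BondConfig (Fin n) | ¬ (openGraph ω).Reachable y x ∧ ¬ (openGraph ω).Reachable y c} ∩ openConn o y := by
    rw [eDy]; congr 1; ext ω; simp only [openConn, mem_setOf_eq]; exact ⟨fun h => h.symm, fun h => h.symm⟩
  rw [Finset.sum_pair hxy, eAx, eAy, eDx, eDy, eAT, eDT] at hL2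
  exact hL2

end GiantKn

end Summit.CriticalPhenomena.PercolationContinuityZ3.Theorems

end
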